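import Mathlib
import Literature.Probability.Moments.HoeffdingDecomposition
import Literature.Computability.Complexity.RandomKSatLowDegreeHardness

/-!
# Route OverlapGapAlgebra, crux `SearchHardWindow` (stmt-PneNP-2460): `L²`-stability of low
# coordinate-degree functions under the `ε`-resampling kernel (Huang–Sellke 2025, Prop. 3.14)

On the finite product space `ι → Γ` (uniform measure, counting form) the `ε`-resampling kernel
`P_ε(y, y') = ∏_i ((1 − ε)·[y i = y' i] + ε/|Γ|)` keeps each coordinate with probability `1 − ε`
and resamples it uniformly from `Γ` with probability `ε`, independently over the coordinates
(O'Donnell 2014 Def. 8.26; Huang–Sellke 2025, arXiv:2501.06427 §3.3). `stub_resampleStability` is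
Huang–Sellke's Prop. 3.14 in second-moment form: a function `F` of coordinate (Efron–Stein) degree
`≤ D` (`IsCoordDegreeLE D F`: a finite sum of `D`-juntas) satisfies
`Σ_{y,y'} P_ε(y,y') (F y − F y')² ≤ 2ε(1 + ε|ι|)·D·Σ_y F y²` for `0 ≤ ε ≤ 1` (we prove the sharp
`2εD Σ F²` and weaken).

Proof (the spectral route of O'Donnell 2014 §8.3–8.4 through the tree's Hoeffding decomposition
`Literature.Probability.Moments.hoeffdingComp`, all steps proved here):
* expanding the product over the set `J` of kept coordinates (`Fintype.prod_add`) writes the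
  kernel as a mixture of "agree on `J`" indicators (`rss_kernel_expand`), and counting the fibres
  of the gluing map `z ↦ Jᶜ.piecewise z y` (`Fintype.prod_sum`, `rss_fibre`, `rss_push`) turns
  each of them into the coordinate averaging `E_{Jᶜ} = coordAvg Jᶜ`:
  `Σ_{y'} P_ε(y,y') H y' = Σ_J (1−ε)^{#J} ε^{#Jᶜ} · E_{Jᶜ} H y` (`rss_action`);
* hence the quadratic form is diagonal in the Hoeffding components (`rss_quad`):
  `Σ_{y,y'} P_ε F y F y' = Σ_J (1−ε)^{#J} ε^{#Jᶜ} ‖E_{Jᶜ} F‖²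
  = Σ_S (Σ_{J ⊇ S} (1−ε)^{#J} ε^{#Jᶜ}) ‖F^{=S}‖² = Σ_S (1−ε)^{#S} ‖F^{=S}‖²`
  (`sum_coordAvg_sq`, `sum_hoeffdingComp_powerset`, `sum_sq_sum_hoeffdingComp`, and the
  binomial theorem on `Sᶜ`, `rss_binom`);
* the kernel is symmetric and stochastic (`rss_kernel_symm`, `rss_kernel_rowsum`), so
  `Σ P_ε (F y − F y')² = 2 Σ_S (1 − (1−ε)^{#S}) ‖F^{=S}‖²`, and Bernoulli's inequality
  (`one_add_mul_le_pow`) together with `F^{=S} = 0` for `#S > D`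
  (`hoeffdingComp_eq_zero_of_degree`) bounds this by `2εD Σ_S ‖F^{=S}‖² = 2εD Σ_y F y²`
  (Parseval, `sum_sq_eq_sum_hoeffdingComp_sq`), which is at most the registered
  `2ε(1 + ε|ι|) D Σ_y F y²` (`rss_main_abstract`, `stub_resampleStability`).

References: B. Huang, M. Sellke, arXiv:2501.06427 (2025), §3.3 Prop. 3.14 [HuangSellke2025];
R. O'Donnell, *Analysis of Boolean Functions*, CUP 2014, §8.3–8.4 [ODonnell2014].
-/

set_option linter.dupNamespace false -- `Summit.PneNP.PneNP.…`: summit = sub-problem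

namespace Summit.PneNP.PneNP.Theorems

open Finset Literature.Probability.Moments
open Literature.Computability.Complexity (IsCoordDegreeLE)

section Helpers

variable {ι Γ : Type*} [Fintype ι] [DecidableEq ι] [Fintype Γ] [DecidableEq Γ]

/-! ### The kernel: one coordinate, stochasticity, symmetry, expansion over kept coordinates -/

/-- One coordinate of the resampling kernel is a probability vector:
`∑_{c : Γ} ((1 − ε)·[a = c] + ε/|Γ|) = 1`. -/
theorem rss_coord_sum_eq_one [Nonempty Γ] (ε : ℝ) (a : Γ) :
    ∑ c : Γ, ((1 - ε) * (if a = c then (1 : ℝ) else 0) + ε / Fintype.card Γ) = 1 := by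
  have hcard : (Fintype.card Γ : ℝ) ≠ 0 := by exact_mod_cast Fintype.card_ne_zero
  rw [Finset.sum_add_distrib, ← Finset.mul_sum, Finset.sum_ite_eq, if_pos (Finset.mem_univ a),
    Finset.sum_const, Finset.card_univ, nsmul_eq_mul, mul_div_cancel₀ _ hcard]
  ring

/-- The resampling kernel is stochastic: `∑_{y'} P_ε(y, y') = 1` (`Fintype.prod_sum` read right
to left, then the one-coordinate identity `rss_coord_sum_eq_one`). -/
theorem rss_kernel_rowsum [Nonempty Γ] (ε : ℝ) (y : ι → Γ) :
    ∑ y' : ι → Γ, ∏ i, ((1 - ε) * (if y i = y' i then (1 : ℝ) else 0) + ε / Fintype.card Γ)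
      = 1 := by
  rw [← Fintype.prod_sum (fun i (c : Γ) =>
    (1 - ε) * (if y i = c then (1 : ℝ) else 0) + ε / Fintype.card Γ)]
  exact Finset.prod_eq_one fun i _ => rss_coord_sum_eq_one ε (y i)

omit [DecidableEq ι] in
/-- The resampling kernel is symmetric in `(y, y')`. -/
theorem rss_kernel_symm (ε : ℝ) (y y' : ι → Γ) :
    (∏ i, ((1 - ε) * (if y i = y' i then (1 : ℝ) else 0) + ε / Fintype.card Γ)) =
      ∏ i, ((1 - ε) * (if y' i = y i then (1 : ℝ) else 0) + ε / Fintype.card Γ) :=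
  Finset.prod_congr rfl fun i _ => by simp only [eq_comm]

/-- Expansion of the kernel over the set `J` of kept coordinates (`Fintype.prod_add`):
`P_ε(y, y') = Σ_J (1−ε)^{#J} (ε/|Γ|)^{#Jᶜ} ∏_{i ∈ J} [y i = y' i]`. -/
theorem rss_kernel_expand (ε : ℝ) (y y' : ι → Γ) :
    (∏ i, ((1 - ε) * (if y i = y' i then (1 : ℝ) else 0) + ε / Fintype.card Γ)) =
      ∑ J : Finset ι, (1 - ε) ^ J.card * (ε / Fintype.card Γ) ^ Jᶜ.card *
        ∏ i ∈ J, (if y i = y' i then (1 : ℝ) else 0) := by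
  rw [Fintype.prod_add]
  refine Finset.sum_congr rfl fun J _ => ?_
  rw [Finset.prod_mul_distrib, Finset.prod_const, Finset.prod_const]
  ring

/-! ### The gluing map `z ↦ Jᶜ.piecewise z y` and the action of the kernel -/

/-- Fibre count of the gluing map `z ↦ Jᶜ.piecewise z y` (coordinates in `J` taken from `y`, the
others from `z`): it hits `y'` exactly `|Γ|^{#J} · [y' agrees with y on J]` times
(`Fintype.prod_sum`: the indicator of `Jᶜ.piecewise z y = y'` factors over the coordinates). -/
theorem rss_fibre (J : Finset ι) (y y' : ι → Γ) :
    ∑ z : ι → Γ, (if Jᶜ.piecewise z y = y' then (1 : ℝ) else 0) =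
      (Fintype.card Γ : ℝ) ^ J.card * ∏ i ∈ J, (if y i = y' i then (1 : ℝ) else 0) := by
  -- the indicator of `Jᶜ.piecewise z y = y'` factors over the coordinates
  have h1 : ∀ z : ι → Γ, (if Jᶜ.piecewise z y = y' then (1 : ℝ) else 0) =
      ∏ i, (if (if i ∈ Jᶜ then z i else y i) = y' i then (1 : ℝ) else 0) := by
    intro z
    rw [Fintype.prod_boole]
    exact if_congr (by simp only [funext_iff, Finset.piecewise]) rfl rfl
  simp only [h1]
  rw [← Fintype.prod_sum (fun i (a : Γ) =>
    if (if i ∈ Jᶜ then a else y i) = y' i then (1 : ℝ) else 0)]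
  -- one coordinate at a time
  have h2 : ∀ i : ι, (∑ a : Γ, if (if i ∈ Jᶜ then a else y i) = y' i then (1 : ℝ) else 0) =
      if i ∈ J then (Fintype.card Γ : ℝ) * (if y i = y' i then (1 : ℝ) else 0) else 1 := by
    intro i
    by_cases hi : i ∈ J
    · have hi' : i ∉ Jᶜ := fun h => (Finset.mem_compl.1 h) hi
      simp only [hi', if_false, hi, if_true, Finset.sum_const, Finset.card_univ, nsmul_eq_mul]
    · have hi' : i ∈ Jᶜ := Finset.mem_compl.2 hi
      simp only [hi', if_true, hi, if_false, Finset.sum_ite_eq', Finset.mem_univ]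
  simp only [h2]
  rw [Fintype.prod_ite_mem, Finset.prod_mul_distrib, Finset.prod_const]

/-- Pushing a sum forward along the gluing map:
`Σ_z H (Jᶜ.piecewise z y) = |Γ|^{#J} · Σ_{y'} [y' agrees with y on J] · H y'`. -/
theorem rss_push (J : Finset ι) (H : (ι → Γ) → ℝ) (y : ι → Γ) :
    ∑ z : ι → Γ, H (Jᶜ.piecewise z y) =
      (Fintype.card Γ : ℝ) ^ J.card *
        ∑ y' : ι → Γ, (∏ i ∈ J, (if y i = y' i then (1 : ℝ) else 0)) * H y' := by
  calc ∑ z : ι → Γ, H (Jᶜ.piecewise z y)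
      = ∑ z : ι → Γ, ∑ y' : ι → Γ, (if Jᶜ.piecewise z y = y' then H y' else 0) := by
        refine Finset.sum_congr rfl fun z _ => ?_
        rw [Fintype.sum_ite_eq]
    _ = ∑ y' : ι → Γ, ∑ z : ι → Γ, (if Jᶜ.piecewise z y = y' then H y' else 0) := Finset.sum_comm
    _ = ∑ y' : ι → Γ, (∑ z : ι → Γ, (if Jᶜ.piecewise z y = y' then (1 : ℝ) else 0)) * H y' := by
        refine Finset.sum_congr rfl fun y' _ => ?_
        rw [Finset.sum_mul]
        exact Finset.sum_congr rfl fun z _ => (boole_mul _ _).symm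
    _ = (Fintype.card Γ : ℝ) ^ J.card *
          ∑ y' : ι → Γ, (∏ i ∈ J, (if y i = y' i then (1 : ℝ) else 0)) * H y' := by
        rw [Finset.mul_sum]
        refine Finset.sum_congr rfl fun y' _ => ?_
        rw [rss_fibre, mul_assoc]

/-- **The kernel as a mixture of coordinate averagings** (the `ε`-noise operator is
`∏_i ((1−ε)·id + ε·E_i) = Σ_J (1−ε)^{#J} ε^{#Jᶜ} E_{Jᶜ}`, O'Donnell 2014 §8.3): for every `H`
and `y`, `Σ_{y'} P_ε(y, y') H y' = Σ_J (1−ε)^{#J} ε^{#Jᶜ} · E_{Jᶜ} H y`. -/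
theorem rss_action [Nonempty Γ] (ε : ℝ) (H : (ι → Γ) → ℝ) (y : ι → Γ) :
    ∑ y' : ι → Γ,
        (∏ i, ((1 - ε) * (if y i = y' i then (1 : ℝ) else 0) + ε / Fintype.card Γ)) * H y' =
      ∑ J : Finset ι, (1 - ε) ^ J.card * ε ^ Jᶜ.card * coordAvg Jᶜ H y := by
  have hΓ : (Fintype.card Γ : ℝ) ≠ 0 := by exact_mod_cast Fintype.card_ne_zero
  simp only [rss_kernel_expand ε, Finset.sum_mul]
  rw [Finset.sum_comm]
  refine Finset.sum_congr rfl fun J _ => ?_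
  have hS : ∑ y' : ι → Γ, (1 - ε) ^ J.card * (ε / Fintype.card Γ) ^ Jᶜ.card *
        (∏ i ∈ J, (if y i = y' i then (1 : ℝ) else 0)) * H y' =
      ((1 - ε) ^ J.card * (ε / Fintype.card Γ) ^ Jᶜ.card) *
        ∑ y' : ι → Γ, (∏ i ∈ J, (if y i = y' i then (1 : ℝ) else 0)) * H y' := by
    rw [Finset.mul_sum]
    exact Finset.sum_congr rfl fun y' _ => by ring
  rw [hS, coordAvg_apply, rss_push, Fintype.card_fun, ← Finset.card_add_card_compl J, pow_add,
    div_pow]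
  push_cast
  rw [mul_div_mul_left _ _ (pow_ne_zero _ hΓ)]
  ring

/-! ### The quadratic form through the Hoeffding components -/

/-- The marginal of the mixture weights (binomial theorem on `Sᶜ` after the reindexing
`J = S ∪ T`, `T ⊆ Sᶜ`): `Σ_{J ⊇ S} (1−ε)^{#J} ε^{#Jᶜ} = (1−ε)^{#S}`. -/
theorem rss_binom (ε : ℝ) (S : Finset ι) :
    ∑ J ∈ (univ : Finset (Finset ι)).filter (fun J => S ⊆ J), (1 - ε) ^ J.card * ε ^ Jᶜ.card =
      (1 - ε) ^ S.card := by
  have hre : ∑ J ∈ (univ : Finset (Finset ι)).filter (fun J => S ⊆ J),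
      (1 - ε) ^ J.card * ε ^ Jᶜ.card =
      ∑ T ∈ Sᶜ.powerset, (1 - ε) ^ S.card * ((∏ _i ∈ T, (1 - ε)) * ∏ _i ∈ Sᶜ \ T, ε) := by
    refine Finset.sum_nbij' (fun J => J \ S) (fun T => S ∪ T) ?_ ?_ ?_ ?_ ?_
    · intro J _
      rw [mem_powerset]
      intro i hi
      exact Finset.mem_compl.2 (Finset.mem_sdiff.1 hi).2
    · intro T _
      simp only [mem_filter, mem_univ, true_and]
      exact subset_union_left
    · intro J hJ
      simp only [mem_filter, mem_univ, true_and] at hJ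
      exact union_sdiff_of_subset hJ
    · intro T hT
      rw [mem_powerset] at hT
      rw [union_sdiff_left, Finset.sdiff_eq_self_iff_disjoint]
      exact disjoint_compl_left.mono_left hT
    · intro J hJ
      simp only [mem_filter, mem_univ, true_and] at hJ
      have h1 : Sᶜ \ (J \ S) = Jᶜ := by
        ext i
        have := @hJ i
        simp only [mem_sdiff, mem_compl]
        tauto
      rw [prod_const, prod_const, h1, ← mul_assoc, ← pow_add, add_comm,
        card_sdiff_add_card_eq_card hJ]
  rw [hre, ← Finset.mul_sum, ← Finset.prod_add]
  simp

/-- Swapping a weighted sum over the pairs `S ⊆ J`: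
`Σ_J w_J Σ_{S ⊆ J} a_S = Σ_S (Σ_{J ⊇ S} w_J) a_S`. -/
theorem rss_swap (w a : Finset ι → ℝ) :
    ∑ J : Finset ι, w J * ∑ S ∈ J.powerset, a S =
      ∑ S : Finset ι, (∑ J ∈ (univ : Finset (Finset ι)).filter (fun J => S ⊆ J), w J) * a S := by
  simp_rw [Finset.mul_sum, Finset.sum_mul]
  exact Finset.sum_comm' fun J S => by
    simp only [mem_univ, mem_powerset, mem_filter, true_and, and_true]

/-- **The quadratic form of the kernel is diagonal in the Hoeffding components**, with
eigenvalue `(1−ε)^{#S}` at level `S` (O'Donnell 2014 §8.3, noise stability):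
`Σ_{y,y'} P_ε(y,y') F y F y' = Σ_S (1−ε)^{#S} ‖F^{=S}‖²`. -/
theorem rss_quad [Nonempty Γ] (ε : ℝ) (F : (ι → Γ) → ℝ) :
    ∑ y : ι → Γ, ∑ y' : ι → Γ,
        (∏ i, ((1 - ε) * (if y i = y' i then (1 : ℝ) else 0) + ε / Fintype.card Γ)) *
          (F y * F y') =
      ∑ S : Finset ι, (1 - ε) ^ S.card * ∑ y, hoeffdingComp S F y ^ 2 := by
  -- let the kernel act on `F` and pull out `F y`
  have h1 : ∀ y : ι → Γ, ∑ y' : ι → Γ,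
      (∏ i, ((1 - ε) * (if y i = y' i then (1 : ℝ) else 0) + ε / Fintype.card Γ)) *
        (F y * F y') =
      F y * ∑ J : Finset ι, (1 - ε) ^ J.card * ε ^ Jᶜ.card * coordAvg Jᶜ F y := by
    intro y
    rw [← rss_action ε F y, Finset.mul_sum]
    exact Finset.sum_congr rfl fun y' _ => by ring
  simp only [h1]
  -- `Σ_y F y · E_{Jᶜ} F y = ‖E_{Jᶜ} F‖² = Σ_{S ⊆ J} ‖F^{=S}‖²`
  have h2 : ∀ J : Finset ι, ∑ y : ι → Γ, F y * coordAvg Jᶜ F y =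
      ∑ S ∈ J.powerset, ∑ y, hoeffdingComp S F y ^ 2 := by
    intro J
    rw [← sum_coordAvg_sq Jᶜ F, ← sum_sq_sum_hoeffdingComp J.powerset F]
    simp only [sum_hoeffdingComp_powerset]
  calc ∑ y : ι → Γ, F y * ∑ J : Finset ι, (1 - ε) ^ J.card * ε ^ Jᶜ.card * coordAvg Jᶜ F y
      = ∑ y : ι → Γ, ∑ J : Finset ι,
          (1 - ε) ^ J.card * ε ^ Jᶜ.card * (F y * coordAvg Jᶜ F y) := by
        refine Finset.sum_congr rfl fun y _ => ?_
        rw [Finset.mul_sum]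
        exact Finset.sum_congr rfl fun J _ => by ring
    _ = ∑ J : Finset ι, (1 - ε) ^ J.card * ε ^ Jᶜ.card * ∑ y : ι → Γ, F y * coordAvg Jᶜ F y := by
        rw [Finset.sum_comm]
        exact Finset.sum_congr rfl fun J _ => by rw [Finset.mul_sum]
    _ = ∑ J : Finset ι, ((1 - ε) ^ J.card * ε ^ Jᶜ.card) *
          ∑ S ∈ J.powerset, ∑ y, hoeffdingComp S F y ^ 2 :=
        Finset.sum_congr rfl fun J _ => by rw [h2]
    _ = ∑ S : Finset ι, (∑ J ∈ (univ : Finset (Finset ι)).filter (fun J => S ⊆ J),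
          (1 - ε) ^ J.card * ε ^ Jᶜ.card) * ∑ y, hoeffdingComp S F y ^ 2 :=
        rss_swap (fun J => (1 - ε) ^ J.card * ε ^ Jᶜ.card) (fun S => ∑ y, hoeffdingComp S F y ^ 2)
    _ = ∑ S : Finset ι, (1 - ε) ^ S.card * ∑ y, hoeffdingComp S F y ^ 2 :=
        Finset.sum_congr rfl fun S _ => by rw [rss_binom]

/-! ### Bernoulli and the abstract second-moment bound -/

/-- Bernoulli's inequality in the form `1 − (1 − ε)^n ≤ n ε` (for `ε ≤ 1`; in fact `ε ≤ 2`
suffices, `one_add_mul_le_pow`). -/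
theorem rss_bernoulli (ε : ℝ) (hε1 : ε ≤ 1) (n : ℕ) : 1 - (1 - ε) ^ n ≤ n * ε := by
  have h := one_add_mul_le_pow (show (-2 : ℝ) ≤ -ε by linarith) n
  have h' : (1 : ℝ) + -ε = 1 - ε := by ring
  rw [h'] at h
  linarith

omit [DecidableEq Γ] in
/-- **Abstract second-moment stability**: if a kernel `P` on `ι → Γ` is stochastic in both
arguments and its quadratic form on `F` is `Σ_S (1−ε)^{#S} ‖F^{=S}‖²`, where `F` is a finite sum
of `D`-juntas, then `Σ_{y,y'} P(y,y') (F y − F y')² ≤ 2εD · Σ_y F y²` (expand the square, Parseval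
`sum_sq_eq_sum_hoeffdingComp_sq`, Bernoulli, and `F^{=S} = 0` for `#S > D`). -/
theorem rss_main_abstract [Nonempty Γ] (ε : ℝ) (hε0 : 0 ≤ ε) (hε1 : ε ≤ 1) {D : ℕ}
    {F : (ι → Γ) → ℝ}
    (hF : ∃ (𝒮 : Finset (Finset ι)) (G : Finset ι → (ι → Γ) → ℝ),
      (∀ T ∈ 𝒮, T.card ≤ D ∧ DependsOn (G T) (↑T : Set ι)) ∧ ∀ y, F y = ∑ T ∈ 𝒮, G T y)
    (P : (ι → Γ) → (ι → Γ) → ℝ) (hrow : ∀ y, ∑ y', P y y' = 1) (hcol : ∀ y', ∑ y, P y y' = 1)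
    (hquad : ∑ y, ∑ y', P y y' * (F y * F y') =
      ∑ S : Finset ι, (1 - ε) ^ S.card * ∑ y, hoeffdingComp S F y ^ 2) :
    ∑ y, ∑ y', P y y' * (F y - F y') ^ 2 ≤ 2 * ε * D * ∑ y, F y ^ 2 := by
  -- expand the square using stochasticity in both arguments
  have hexp : ∑ y, ∑ y', P y y' * (F y - F y') ^ 2 =
      2 * ∑ y, F y ^ 2 - 2 * ∑ y, ∑ y', P y y' * (F y * F y') := by
    have h1 : ∀ y, ∑ y', F y ^ 2 * P y y' = F y ^ 2 := fun y => by
      rw [← Finset.mul_sum, hrow, mul_one]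
    have h2 : ∑ y, ∑ y', P y y' * F y' ^ 2 = ∑ y', F y' ^ 2 := by
      rw [Finset.sum_comm]
      refine Finset.sum_congr rfl fun y' _ => ?_
      rw [← Finset.sum_mul, hcol, one_mul]
    calc ∑ y, ∑ y', P y y' * (F y - F y') ^ 2
        = ∑ y, ∑ y', (F y ^ 2 * P y y' + P y y' * F y' ^ 2 - 2 * (P y y' * (F y * F y'))) :=
          Finset.sum_congr rfl fun y _ => Finset.sum_congr rfl fun y' _ => by ring
      _ = ∑ y, (F y ^ 2 + ∑ y', P y y' * F y' ^ 2 - 2 * ∑ y', P y y' * (F y * F y')) := by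
          refine Finset.sum_congr rfl fun y _ => ?_
          rw [Finset.sum_sub_distrib, Finset.sum_add_distrib, h1, Finset.mul_sum]
      _ = 2 * ∑ y, F y ^ 2 - 2 * ∑ y, ∑ y', P y y' * (F y * F y') := by
          rw [Finset.sum_sub_distrib, Finset.sum_add_distrib, h2, ← Finset.mul_sum]
          ring
  rw [hexp, hquad, sum_sq_eq_sum_hoeffdingComp_sq F, Finset.powerset_univ, Finset.mul_sum,
    Finset.mul_sum, Finset.mul_sum, ← Finset.sum_sub_distrib]
  refine Finset.sum_le_sum fun S _ => ?_
  have ha : 0 ≤ ∑ y, hoeffdingComp S F y ^ 2 := Finset.sum_nonneg fun y _ => sq_nonneg _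
  by_cases hS : S.card ≤ D
  · have hb : 1 - (1 - ε) ^ S.card ≤ D * ε :=
      (rss_bernoulli ε hε1 S.card).trans (mul_le_mul_of_nonneg_right (by exact_mod_cast hS) hε0)
    have key := mul_le_mul_of_nonneg_right hb ha
    linarith
  · have hz : ∑ y, hoeffdingComp S F y ^ 2 = 0 := by
      simp [hoeffdingComp_eq_zero_of_degree hF (not_le.1 hS)]
    simp [hz]

end Helpers

/-- **`L²`-stability of low coordinate-degree functions under the `ε`-resampling kernel**
(Huang–Sellke 2025, arXiv:2501.06427, Prop. 3.14, second-moment form; O'Donnell 2014 §8.3–8.4):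
on the finite product space `ι → Γ` with the uniform measure, for `0 ≤ ε ≤ 1` and every `F` of
coordinate (Efron–Stein) degree `≤ D`,
`Σ_{y,y'} P_ε(y,y') (F y − F y')² ≤ 2ε(1 + ε|ι|)·D·Σ_y F y²`, where
`P_ε(y,y') = ∏_i ((1−ε)·[y i = y' i] + ε/|Γ|)`. (The sharp constant `2εD` is proved in
`rss_main_abstract`; `1 ≤ 1 + ε|ι|` gives the registered form.) -/
theorem stub_resampleStability {ι Γ : Type*} [Fintype ι] [DecidableEq ι] [Fintype Γ]
    [DecidableEq Γ] [Nonempty Γ] (ε : ℝ) (hε0 : 0 ≤ ε) (hε1 : ε ≤ 1) {D : ℕ} {F : (ι → Γ) → ℝ}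
    (hF : IsCoordDegreeLE D F) :
    ∑ y : ι → Γ, ∑ y' : ι → Γ,
        (∏ i, ((1 - ε) * (if y i = y' i then (1 : ℝ) else 0) + ε / Fintype.card Γ)) *
          (F y - F y') ^ 2
      ≤ 2 * ε * (1 + ε * Fintype.card ι) * D * ∑ y, F y ^ 2 := by
  have hcol : ∀ y' : ι → Γ,
      ∑ y : ι → Γ, (∏ i, ((1 - ε) * (if y i = y' i then (1 : ℝ) else 0) + ε / Fintype.card Γ))
        = 1 :=
    fun y' => (Finset.sum_congr rfl fun y _ => rss_kernel_symm ε y y').trans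
      (rss_kernel_rowsum ε y')
  have hmain := rss_main_abstract ε hε0 hε1 hF
    (fun y y' => ∏ i, ((1 - ε) * (if y i = y' i then (1 : ℝ) else 0) + ε / Fintype.card Γ))
    (rss_kernel_rowsum ε) hcol (rss_quad ε F)
  have hX : 0 ≤ ∑ y, F y ^ 2 := Finset.sum_nonneg fun y _ => sq_nonneg _
  have hD : (0 : ℝ) ≤ D := Nat.cast_nonneg D
  have hextra : 0 ≤ 2 * ε * (ε * Fintype.card ι) * D * ∑ y, F y ^ 2 := by positivity
  calc _ ≤ 2 * ε * D * ∑ y, F y ^ 2 := hmain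
    _ = 2 * ε * (1 + ε * Fintype.card ι) * D * ∑ y, F y ^ 2
          - 2 * ε * (ε * Fintype.card ι) * D * ∑ y, F y ^ 2 := by ring
    _ ≤ 2 * ε * (1 + ε * Fintype.card ι) * D * ∑ y, F y ^ 2 := by linarith

end Summit.PneNP.PneNP.Theorems
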